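import Literature.Analysis.FunctionSpaces.BMO
import Mathlib.MeasureTheory.Covering.DensityTheorem
import Mathlib.MeasureTheory.Covering.Vitali
import Mathlib.MeasureTheory.Measure.Lebesgue.EqHaar
import HarnessLib

/-!
# The John–Nirenberg inequality (discharge of `Literature.Analysis.FunctionSpaces.john_nirenberg`)

Topic `Analysis/FunctionSpaces`; sibling proof file of `BMO.lean`. It **proves the named fact
`Literature.Analysis.FunctionSpaces.john_nirenberg`** (John–Nirenberg 1961, Lemma 1'; Stein, *Harmonic Analysis*, IV.1.3,
Corollary): there are `c₁, c₂ > 0` depending only on `dim E` such that for every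
`f ∈ BMO(E; F)` (Bochner, `F` complete), every ball `B` and every `t > 0`,
`|{x ∈ B : ‖f(x) - f_B‖ > t ‖f‖_*}| ≤ c₁ e^{-c₂ t} |B|`; here `c₁ = 2`, `c₂ = log 2 / A`,
`A = 2·8^d(1+2^d)`.

## The proof (John–Nirenberg's Calderón–Zygmund iteration, run with balls)

The seminorm of `BMO.lean` is taken over balls, so we run John–Nirenberg's argument with balls,
the Vitali covering lemma and Lebesgue's differentiation theorem in place of dyadic cubes:

* `§ Averages`, `§ Balls`: Jensen for averages, comparison of averages over nested balls of
  comparable measure (`‖f_{B'} - f_{B''}‖ ≤ (|B''|/|B'|) ⨍_{B''} ‖f - f_{B''}‖`), null spheres.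
* `§ Step` (`measure_level_add_le`): fix a ball `B = B(z, ρ)`, `a = A‖f‖_*` and `λ ≥ 0`. At
  a.e. point `x ∈ B` with `‖f(x) - f_B‖ > λ + a` the averages of `‖f - f_B‖` over
  `B̄(x, ρ2^{-k})` tend to `‖f(x) - f_B‖ > a` (Lebesgue), while the average over `B(x, ρ)` is
  `≤ (1 + 2^{d+1})‖f‖_* < a`; the first dyadic radius `sₓ = ρ2^{-kₓ}`, `kₓ ≥ 1`, with average
  `> a` gives a stopping ball with `|B̄(x,sₓ)| ≤ a⁻¹ ∫_{B̄(x,sₓ)} ‖f - f_B‖` and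
  `‖f_{B(x,4sₓ)} - f_B‖ ≤ a`. By Vitali, disjoint stopping balls `B̄(b, s_b)` with the `B(b, 4s_b)`
  covering the level set; on each, `‖f - f_{B(b,4s_b)}‖ > λ`, so the level set has measure
  `≤ Θ(λ) 4^d Σ|B̄(b,s_b)| ≤ Θ(λ) 4^d a⁻¹ ∫_{B(z,2ρ)} ‖f - f_B‖ ≤ ½ Θ(λ) |B|`, where
  `Θ(λ) = sup_{B'} |{‖f - f_{B'}‖ > λ} ∩ B'|/|B'|`.
* `§ Iterate`: hence `Θ(λ + a) ≤ ½ Θ(λ)`, `Θ(na) ≤ 2^{-n}`, and with `n = ⌊t/A⌋`,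
  `2^{-n} ≤ 2e^{-(log 2/A)t}`; the case `‖f‖_* = 0` (`f = f_B` a.e.) is separate.

Only theorems are declared (no new definitions).

## References

* F. John, L. Nirenberg, *On functions of bounded mean oscillation*, Comm. Pure Appl. Math. 14
  (1961), Lemma 1'.
* E. M. Stein, *Harmonic Analysis* (1993), Chapter IV, §1.3.
-/

noncomputable section

open MeasureTheory Metric Filter Topology Set
open scoped ENNReal NNReal

namespace Literature.Analysis.FunctionSpaces

namespace JohnNirenberg

/-! ## Averages: Jensen and comparison of ball averages -/

section Averages

variable {α : Type*} [MeasurableSpace α] {μ : Measure α}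
variable {F : Type*} [NormedAddCommGroup F] [NormedSpace ℝ F]

/-- Jensen for set averages: `‖⨍_s f‖ ≤ ⨍_s ‖f‖`. [folklore] -/
theorem norm_setAverage_le_setAverage_norm (f : α → F) (s : Set α) :
    ‖⨍ z in s, f z ∂μ‖ ≤ ⨍ z in s, ‖f z‖ ∂μ := by
  rw [setAverage_eq, setAverage_eq, norm_smul, Real.norm_of_nonneg (by positivity), smul_eq_mul]
  exact mul_le_mul_of_nonneg_left (norm_integral_le_integral_norm _) (by positivity)

/-- `⨍_s (f - c) = ⨍_s f - c` on a set of finite positive measure. [folklore] -/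
theorem setAverage_sub_const [CompleteSpace F] {f : α → F} {s : Set α} (hf : IntegrableOn f s μ)
    (hs₀ : μ s ≠ 0) (hs : μ s ≠ ∞) (c : F) :
    ⨍ z in s, (f z - c) ∂μ = (⨍ z in s, f z ∂μ) - c := by
  have hc : IntegrableOn (fun _ => c) s μ := integrableOn_const hs
  rw [setAverage_eq, setAverage_eq, integral_sub hf hc, smul_sub, setIntegral_const, smul_smul,
    measureReal_def, inv_mul_cancel₀ (ENNReal.toReal_ne_zero.mpr ⟨hs₀, hs⟩), one_smul]

/-- **Comparison of averages over nested sets**: for `s ⊆ s'` of finite positive measure,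
`‖f_s - f_{s'}‖ ≤ (μ(s')/μ(s)) ⨍_{s'} ‖f - f_{s'}‖`. [folklore] -/
theorem norm_setAverage_sub_setAverage_le [CompleteSpace F] {f : α → F} {s s' : Set α} (hss' : s ⊆ s')
    (hf : IntegrableOn f s' μ) (hs₀ : μ s ≠ 0) (hs' : μ s' ≠ ∞) :
    ‖(⨍ z in s, f z ∂μ) - ⨍ z in s', f z ∂μ‖ ≤
      μ.real s' / μ.real s * ⨍ z in s', ‖f z - ⨍ w in s', f w ∂μ‖ ∂μ := by
  have hs : μ s ≠ ∞ := (lt_of_le_of_lt (measure_mono hss') hs'.lt_top).ne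
  have hspos : 0 < μ.real s := ENNReal.toReal_pos hs₀ hs
  set c : F := ⨍ z in s', f z ∂μ with hc
  rw [← setAverage_sub_const (hf.mono_set hss') hs₀ hs c]
  refine (norm_setAverage_le_setAverage_norm _ _).trans ?_
  rw [setAverage_eq, setAverage_eq, smul_eq_mul, smul_eq_mul, div_eq_mul_inv,
    mul_comm (μ.real s'), mul_assoc]
  refine mul_le_mul_of_nonneg_left ?_ (by positivity)
  by_cases hs'0 : μ s' = 0
  · exact absurd (measure_mono_null hss' hs'0) hs₀
  have hs'pos : 0 < μ.real s' := ENNReal.toReal_pos hs'0 hs'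
  rw [mul_inv_cancel_left₀ hs'pos.ne']
  refine setIntegral_mono_set ?_ (Eventually.of_forall fun z => norm_nonneg _) hss'.eventuallyLE
  exact (hf.sub (integrableOn_const hs')).norm

end Averages

section Averages2

variable {α : Type*} [MeasurableSpace α] {μ : Measure α}
variable {F : Type*} [NormedAddCommGroup F] [NormedSpace ℝ F]

omit [NormedSpace ℝ F] in
/-- Moving the centring constant: `⨍_s ‖f - c‖ ≤ ⨍_s ‖f - c'‖ + ‖c' - c‖`. [folklore] -/
theorem setAverage_norm_sub_le_add {f : α → F} {s : Set α} (hf : IntegrableOn f s μ)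
    (hs₀ : μ s ≠ 0) (hs : μ s ≠ ∞) (c c' : F) :
    ⨍ z in s, ‖f z - c‖ ∂μ ≤ (⨍ z in s, ‖f z - c'‖ ∂μ) + ‖c' - c‖ := by
  have h1 : ∀ z, ‖f z - c‖ ≤ ‖f z - c'‖ + ‖c' - c‖ := fun z => by
    calc ‖f z - c‖ = ‖(f z - c') + (c' - c)‖ := by rw [sub_add_sub_cancel]
      _ ≤ ‖f z - c'‖ + ‖c' - c‖ := norm_add_le _ _
  have hi1 : IntegrableOn (fun z => ‖f z - c‖) s μ := (hf.sub (integrableOn_const hs)).norm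
  have hi2 : IntegrableOn (fun z => ‖f z - c'‖ + ‖c' - c‖) s μ :=
    (hf.sub (integrableOn_const hs)).norm.add (integrableOn_const hs)
  calc ⨍ z in s, ‖f z - c‖ ∂μ ≤ ⨍ z in s, (‖f z - c'‖ + ‖c' - c‖) ∂μ := by
        rw [setAverage_eq, setAverage_eq, smul_eq_mul, smul_eq_mul]
        exact mul_le_mul_of_nonneg_left (setIntegral_mono hi1 hi2 h1) (by positivity)
    _ = (⨍ z in s, ‖f z - c'‖ ∂μ) + ‖c' - c‖ := by
        have hi3 : IntegrableOn (fun z => ‖f z - c'‖) s μ := (hf.sub (integrableOn_const hs)).norm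
        rw [setAverage_eq, setAverage_eq, integral_add hi3 (integrableOn_const hs),
          smul_add, setIntegral_const, smul_smul, measureReal_def,
          inv_mul_cancel₀ (ENNReal.toReal_ne_zero.mpr ⟨hs₀, hs⟩), one_smul, smul_eq_mul]

/-- If the average of a nonnegative integrable function over `s` exceeds `a > 0`, then
`μ(s) ≤ a⁻¹ ∫_s g`. [folklore] -/
theorem measure_le_of_lt_setAverage {g : α → ℝ} {s : Set α} (hs : μ s ≠ ∞) {a : ℝ} (ha : 0 < a)
    (havg : a < ⨍ z in s, g z ∂μ) : μ s ≤ ENNReal.ofReal (a⁻¹ * ∫ z in s, g z ∂μ) := by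
  by_cases hs₀ : μ s = 0
  · rw [hs₀]; exact zero_le
  have hspos : 0 < μ.real s := ENNReal.toReal_pos hs₀ hs
  rw [setAverage_eq, smul_eq_mul] at havg
  have h1 : a * μ.real s < ∫ z in s, g z ∂μ := by
    have := mul_lt_mul_of_pos_right havg hspos
    rwa [mul_comm ((μ.real s)⁻¹), inv_mul_cancel_right₀ hspos.ne'] at this
  have h2 : μ.real s ≤ a⁻¹ * ∫ z in s, g z ∂μ := by
    rw [← div_eq_inv_mul, le_div_iff₀ ha, mul_comm]; exact h1.le
  calc μ s = ENNReal.ofReal (μ.real s) := (ENNReal.ofReal_toReal hs).symm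
    _ ≤ _ := ENNReal.ofReal_le_ofReal h2

end Averages2

/-! ## Geometry of balls for the Lebesgue measure -/

section Balls

variable {E : Type*} [NormedAddCommGroup E] [InnerProductSpace ℝ E] [FiniteDimensional ℝ E]
  [MeasurableSpace E] [BorelSpace E]

/-- Closed and open balls of positive radius agree up to a null set. [folklore] -/
theorem closedBall_ae_eq_ball (x : E) {r : ℝ} (hr : 0 < r) :
    closedBall x r =ᵐ[volume] ball x r := by
  refine (ae_eq_set).mpr ⟨?_, by rw [sdiff_eq_bot_iff.mpr ball_subset_closedBall]; exact measure_empty⟩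
  have hsub : closedBall x r \ ball x r ⊆ sphere x r := fun y hy =>
    mem_sphere.mpr (le_antisymm (mem_closedBall.mp hy.1) (not_lt.mp (fun h => hy.2 (mem_ball.mpr h))))
  refine measure_mono_null hsub ?_
  rcases subsingleton_or_nontrivial E with hE | hE
  · have : sphere x r = ∅ := by
      ext y
      simp only [mem_sphere, mem_empty_iff_false, iff_false, Subsingleton.elim y x, dist_self]
      exact hr.ne
    rw [this, measure_empty]
  · exact Measure.addHaar_sphere volume x r

/-- Averages over closed and open balls of positive radius agree. [folklore] -/
theorem setAverage_closedBall_eq {F : Type*} [NormedAddCommGroup F] [NormedSpace ℝ F]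
    (f : E → F) (x : E) {r : ℝ} (hr : 0 < r) : ⨍ z in closedBall x r, f z = ⨍ z in ball x r, f z := by
  unfold average
  rw [Measure.restrict_congr_set (closedBall_ae_eq_ball x hr)]

/-- The Lebesgue measures of closed and open balls of positive radius agree. [folklore] -/
theorem volume_closedBall_eq_volume_ball (x : E) {r : ℝ} (hr : 0 < r) : volume (closedBall x r) = volume (ball x r) :=
  measure_congr (closedBall_ae_eq_ball x hr)

/-- Scaling of the Lebesgue measure of balls: `|B(x, c r)| = c^d |B(x', r)|`. [folklore] -/
theorem volume_ball_mul (x x' : E) {c r : ℝ} (hc : 0 < c) (hr : 0 < r) :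
    volume (ball x (c * r)) = ENNReal.ofReal (c ^ Module.finrank ℝ E) * volume (ball x' r) := by
  rw [Measure.addHaar_ball_of_pos volume x (by positivity), Measure.addHaar_ball_of_pos volume x' hr,
    mul_pow, ENNReal.ofReal_mul (by positivity), mul_assoc]

/-- Real-valued form of `volume_ball_mul`. [folklore] -/
theorem volumeReal_ball_mul (x x' : E) {c r : ℝ} (hc : 0 < c) (hr : 0 < r) :
    volume.real (ball x (c * r)) = c ^ Module.finrank ℝ E * volume.real (ball x' r) := by
  rw [measureReal_def, volume_ball_mul x x' hc hr, ENNReal.toReal_mul, ENNReal.toReal_ofReal (by positivity),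
    measureReal_def]

/-- Balls of the same radius have the same measure. [folklore] -/
theorem volume_ball_eq (x x' : E) (r : ℝ) : volume (ball x r) = volume (ball x' r) := by
  rcases le_or_gt r 0 with h | h
  · rw [ball_eq_empty.mpr h, ball_eq_empty.mpr h]
  · have := volume_ball_mul x x' one_pos h
    rwa [one_mul, one_pow, ENNReal.ofReal_one, one_mul] at this

end Balls

/-! ## The covering step -/

section Step

variable {E : Type*} [NormedAddCommGroup E] [InnerProductSpace ℝ E] [FiniteDimensional ℝ E]
  [MeasurableSpace E] [BorelSpace E]
variable {F : Type*} [NormedAddCommGroup F] [NormedSpace ℝ F] [CompleteSpace F]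

/-- Ball averages of a `BMO`-type function at comparable scales: if `ball x r ⊆ ball x' r'` and
`r' ≤ c r`, then `‖f_{B(x,r)} - f_{B(x',r')}‖ ≤ c^d K`. [folklore] -/
theorem norm_ballAverage_sub_ballAverage_le {f : E → F} (hf : LocallyIntegrable f) {K : ℝ}
    (hK : ∀ (x : E) (r : ℝ), 0 < r → ⨍ z in ball x r, ‖f z - ⨍ w in ball x r, f w‖ ≤ K)
    {x x' : E} {r r' c : ℝ} (hr : 0 < r) (hc : 0 < c) (hsub : ball x r ⊆ ball x' r') (hcr : r' ≤ c * r) :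
    ‖(⨍ z in ball x r, f z) - ⨍ z in ball x' r', f z‖ ≤ c ^ Module.finrank ℝ E * K := by
  have hr' : 0 < r' := by
    by_contra h
    have := hsub (mem_ball_self hr)
    rw [ball_eq_empty.mpr (not_lt.mp h)] at this
    exact this
  have hK0 : 0 ≤ K := le_trans (by
    rw [setAverage_eq, smul_eq_mul]
    exact mul_nonneg (by positivity) (integral_nonneg fun z => norm_nonneg _)) (hK x r hr)
  have hfi : IntegrableOn f (ball x' r') := (hf.integrableOn_isCompact (isCompact_closedBall x' r')).mono_set
    ball_subset_closedBall
  have h1 := norm_setAverage_sub_setAverage_le (μ := volume) hsub hfi (measure_ball_pos volume x hr).ne'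
    measure_ball_lt_top.ne
  refine h1.trans ?_
  have hratio : volume.real (ball x' r') / volume.real (ball x r) ≤ c ^ Module.finrank ℝ E := by
    rw [div_le_iff₀ (by
      rw [measureReal_def]; exact ENNReal.toReal_pos (measure_ball_pos volume x hr).ne' measure_ball_lt_top.ne)]
    calc volume.real (ball x' r') ≤ volume.real (ball x' (c * r)) := by
          exact measureReal_mono (ball_subset_ball hcr) measure_ball_lt_top.ne
      _ = c ^ Module.finrank ℝ E * volume.real (ball x r) := volumeReal_ball_mul x' x hc hr
  exact mul_le_mul hratio (hK x' r' hr') (by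
    rw [setAverage_eq, smul_eq_mul]
    exact mul_nonneg (by positivity) (integral_nonneg fun z => norm_nonneg _)) (by positivity)

omit [NormedSpace ℝ F] [CompleteSpace F] in
/-- Set averages of real nonnegative integrands are nonnegative. [folklore] -/
theorem setAverage_norm_nonneg {f : E → F} (c : F) (s : Set E) : 0 ≤ ⨍ z in s, ‖f z - c‖ := by
  rw [setAverage_eq, smul_eq_mul]
  exact mul_nonneg (by positivity) (integral_nonneg fun z => norm_nonneg _)

/-- **The covering step of the John–Nirenberg inequality with balls** (John–Nirenberg 1961,
Lemma 1', Calderón–Zygmund step; here with the Vitali covering lemma and Lebesgue's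
differentiation theorem in place of dyadic cubes): let `⨍_B ‖f - f_B‖ ≤ K` for all balls, let
`A = 2·8^d(1+2^d)` and suppose `|{y ∈ B' : λ < ‖f - f_{B'}‖}| ≤ Θ |B'|` for all balls `B'`. Then
for every ball `B` and `λ ≥ 0`, `|{y ∈ B : λ + AK < ‖f - f_B‖}| ≤ ½ Θ |B|`. [cite: JohnNirenberg1961, Lemma 1'] -/
theorem measure_level_add_le {f : E → F} (hf : LocallyIntegrable f) {K : ℝ} (hK0 : 0 < K)
    (hK : ∀ (x : E) (r : ℝ), 0 < r → ⨍ z in ball x r, ‖f z - ⨍ w in ball x r, f w‖ ≤ K)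
    {Θ : ℝ≥0∞} {lam : ℝ} (hlam : 0 ≤ lam)
    (hΘ : ∀ (x : E) (r : ℝ), 0 < r →
      volume {y ∈ ball x r | lam < ‖f y - ⨍ w in ball x r, f w‖} ≤ Θ * volume (ball x r))
    (z : E) {ρ : ℝ} (hρ : 0 < ρ) :
    volume {y ∈ ball z ρ | lam + 2 * 8 ^ Module.finrank ℝ E * (1 + 2 ^ Module.finrank ℝ E) * K <
        ‖f y - ⨍ w in ball z ρ, f w‖} ≤ 2⁻¹ * Θ * volume (ball z ρ) := by
  set d : ℕ := Module.finrank ℝ E with hd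
  set A : ℝ := 2 * 8 ^ d * (1 + 2 ^ d) with hA
  set a : ℝ := A * K with ha
  have ha0 : 0 < a := by positivity
  set B : Set E := ball z ρ with hB
  set cB : F := ⨍ w in B, f w with hcB
  set g : E → ℝ := fun y => ‖f y - cB‖ with hg
  have hg0 : ∀ y, 0 ≤ g y := fun y => norm_nonneg _
  have hgl : LocallyIntegrable g :=
    locallyIntegrableOn_univ.mp ((locallyIntegrableOn_univ.mpr (hf.sub (locallyIntegrable_const cB))).norm)
  set Λ : Set E := {y ∈ B | lam + a < g y} with hΛ
  show volume Λ ≤ 2⁻¹ * Θ * volume B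
  -- integrability on balls
  have hfB : ∀ (x : E) (r : ℝ), IntegrableOn f (ball x r) := fun x r =>
    (hf.integrableOn_isCompact (isCompact_closedBall x r)).mono_set ball_subset_closedBall
  have hgB : ∀ (x : E) (r : ℝ), IntegrableOn g (ball x r) := fun x r =>
    (hgl.integrableOn_isCompact (isCompact_closedBall x r)).mono_set ball_subset_closedBall
  -- averages of `g` over balls controlled by `K` and the distance of centres
  have hosc : ∀ (x : E) (r : ℝ), 0 < r → ⨍ y in ball x r, g y ≤ K + ‖(⨍ w in ball x r, f w) - cB‖ := by
    intro x r hr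
    exact (setAverage_norm_sub_le_add (hfB x r) (measure_ball_pos volume x hr).ne' measure_ball_lt_top.ne cB
      (⨍ w in ball x r, f w)).trans (add_le_add (hK x r hr) le_rfl)
  -- (i) the average over `B(x, ρ)`, `x ∈ B`, is small
  have hbig : ∀ x ∈ B, ⨍ y in ball x ρ, g y ≤ (1 + 2 ^ (d + 1)) * K := by
    intro x hx
    have h1 : ‖(⨍ w in ball x ρ, f w) - ⨍ w in ball z (2 * ρ), f w‖ ≤ 2 ^ d * K :=
      norm_ballAverage_sub_ballAverage_le hf hK hρ two_pos (fun y hy => by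
        rw [mem_ball] at hy hx ⊢; linarith [dist_triangle y x z]) le_rfl
    have h2 : ‖cB - ⨍ w in ball z (2 * ρ), f w‖ ≤ 2 ^ d * K :=
      norm_ballAverage_sub_ballAverage_le hf hK hρ two_pos (ball_subset_ball (by linarith)) le_rfl
    have h3 : ‖(⨍ w in ball x ρ, f w) - cB‖ ≤ 2 ^ d * K + 2 ^ d * K := by
      calc ‖(⨍ w in ball x ρ, f w) - cB‖
          = ‖((⨍ w in ball x ρ, f w) - ⨍ w in ball z (2 * ρ), f w) - (cB - ⨍ w in ball z (2 * ρ), f w)‖ := by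
            rw [sub_sub_sub_cancel_right]
        _ ≤ _ := (norm_sub_le _ _).trans (add_le_add h1 h2)
    calc ⨍ y in ball x ρ, g y ≤ K + ‖(⨍ w in ball x ρ, f w) - cB‖ := hosc x ρ hρ
      _ ≤ K + (2 ^ d * K + 2 ^ d * K) := by linarith
      _ = (1 + 2 ^ (d + 1)) * K := by ring
  -- (ii) the average over `B(x, 2ρ)`, `x ∈ B`
  have hbig2 : ∀ x ∈ B, ‖(⨍ w in ball x (2 * ρ), f w) - cB‖ ≤ ((3 / 2) ^ d + 3 ^ d) * K := by
    intro x hx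
    have h1 : ‖(⨍ w in ball x (2 * ρ), f w) - ⨍ w in ball z (3 * ρ), f w‖ ≤ (3 / 2) ^ d * K :=
      norm_ballAverage_sub_ballAverage_le hf hK (by positivity) (by positivity) (fun y hy => by
        rw [mem_ball] at hy hx ⊢; linarith [dist_triangle y x z]) (by linarith)
    have h2 : ‖cB - ⨍ w in ball z (3 * ρ), f w‖ ≤ 3 ^ d * K :=
      norm_ballAverage_sub_ballAverage_le hf hK hρ (by positivity) (ball_subset_ball (by linarith)) le_rfl
    calc ‖(⨍ w in ball x (2 * ρ), f w) - cB‖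
        = ‖((⨍ w in ball x (2 * ρ), f w) - ⨍ w in ball z (3 * ρ), f w) - (cB - ⨍ w in ball z (3 * ρ), f w)‖ := by
          rw [sub_sub_sub_cancel_right]
      _ ≤ (3 / 2) ^ d * K + 3 ^ d * K := (norm_sub_le _ _).trans (add_le_add h1 h2)
      _ = _ := by ring
  -- the size of `A`
  have hA1 : (1 + 2 ^ (d + 1)) * K < a := by
    rw [ha, hA]
    have h8 : (1 : ℝ) ≤ 8 ^ d := one_le_pow₀ (by norm_num)
    have h2 : (1 : ℝ) ≤ 2 ^ d := one_le_pow₀ (by norm_num)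
    have : (1 + 2 ^ (d + 1) : ℝ) < 2 * 8 ^ d * (1 + 2 ^ d) := by
      rw [pow_succ]; nlinarith
    exact mul_lt_mul_of_pos_right this hK0
  have hA2 : ((3 / 2) ^ d + 3 ^ d) * K ≤ a := by
    rw [ha, hA]
    refine mul_le_mul_of_nonneg_right ?_ hK0.le
    have h1 : ((3 : ℝ) / 2) ^ d ≤ 8 ^ d := pow_le_pow_left₀ (by norm_num) (by norm_num) d
    have h2 : (3 : ℝ) ^ d ≤ 8 ^ d := pow_le_pow_left₀ (by norm_num) (by norm_num) d
    have h3 : (1 : ℝ) ≤ 2 ^ d := one_le_pow₀ (by norm_num)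
    nlinarith [pow_nonneg (by norm_num : (0 : ℝ) ≤ 8) d]
  -- Lebesgue differentiation for `g` along the radii `ρ / 2^j`
  set rad : ℕ → ℝ := fun j => ρ / 2 ^ j with hrad
  have hrad0 : ∀ j, 0 < rad j := fun j => by positivity
  have hrad_tendsto : Tendsto rad atTop (𝓝[>] 0) := by
    rw [tendsto_nhdsWithin_iff]
    refine ⟨?_, Eventually.of_forall fun j => hrad0 j⟩
    have : Tendsto (fun j : ℕ => ρ * (2⁻¹ : ℝ) ^ j) atTop (𝓝 (ρ * 0)) :=
      (tendsto_pow_atTop_nhds_zero_of_lt_one (by norm_num) (by norm_num)).const_mul ρ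
    rw [mul_zero] at this
    refine this.congr fun j => ?_
    simp only [hrad, inv_pow, div_eq_mul_inv]
  have hLeb : ∀ᵐ x ∂(volume : Measure E), Tendsto (fun j => ⨍ y in closedBall x (rad j), g y) atTop (𝓝 (g x)) := by
    filter_upwards [IsUnifLocDoublingMeasure.ae_tendsto_average (volume : Measure E) hgl 1] with x hx
    exact hx (fun _ => x) rad hrad_tendsto (Eventually.of_forall fun j => by
      rw [one_mul]; exact mem_closedBall_self (hrad0 j).le)
  set G : Set E := {x | Tendsto (fun j => ⨍ y in closedBall x (rad j), g y) atTop (𝓝 (g x))} with hG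
  have hGc : volume Gᶜ = 0 := by
    rw [hG, compl_setOf]
    exact ae_iff.mp hLeb
  set Λ' : Set E := Λ ∩ G with hΛ'
  have hΛΛ' : volume Λ ≤ volume Λ' := by
    calc volume Λ ≤ volume (Λ' ∪ Gᶜ) := measure_mono fun y hy => by
          by_cases h : y ∈ G
          · exact Or.inl ⟨hy, h⟩
          · exact Or.inr h
      _ ≤ volume Λ' + volume Gᶜ := measure_union_le _ _
      _ = volume Λ' := by rw [hGc, add_zero]
  -- the stopping index at each point of `Λ'`
  have hstop : ∀ x, ∃ k : ℕ, x ∈ Λ' → (1 ≤ k ∧ a < ⨍ y in closedBall x (rad k), g y ∧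
      ∀ k', k' < k → ⨍ y in closedBall x (rad k'), g y ≤ a) := by
    intro x
    by_cases hx : x ∈ Λ'
    · have hgx : a < g x := lt_of_le_of_lt (le_add_of_nonneg_left hlam) hx.1.2
      have hev : ∃ k, a < ⨍ y in closedBall x (rad k), g y :=
        ((tendsto_order.1 hx.2).1 a hgx).exists
      classical
      refine ⟨Nat.find hev, fun _ => ⟨?_, Nat.find_spec hev, fun k' hk' => not_lt.mp (Nat.find_min hev hk')⟩⟩
      rw [Nat.one_le_iff_ne_zero]
      intro h0
      have h1 := Nat.find_spec hev
      rw [h0] at h1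
      have h2 : ⨍ y in closedBall x (rad 0), g y ≤ (1 + 2 ^ (d + 1)) * K := by
        rw [setAverage_closedBall_eq _ _ (hrad0 0)]
        simp only [hrad, pow_zero, div_one]
        exact hbig x hx.1.1
      linarith
    · exact ⟨1, fun h => absurd h hx⟩
  choose k hk using hstop
  set sx : E → ℝ := fun x => rad (k x) with hsx
  have hsx0 : ∀ x, 0 < sx x := fun x => hrad0 _
  have hsxρ : ∀ x ∈ Λ', sx x ≤ ρ / 2 := by
    intro x hx
    have h1 := (hk x hx).1
    show ρ / 2 ^ k x ≤ ρ / 2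
    exact div_le_div_of_nonneg_left hρ.le two_pos (by
      calc (2 : ℝ) = 2 ^ 1 := (pow_one 2).symm
        _ ≤ 2 ^ k x := pow_le_pow_right₀ one_le_two h1)
  -- (P1) mass bound for the stopping balls
  have hP1 : ∀ x ∈ Λ', volume (closedBall x (sx x)) ≤ ENNReal.ofReal (a⁻¹ * ∫ y in closedBall x (sx x), g y) :=
    fun x hx => measure_le_of_lt_setAverage measure_closedBall_lt_top.ne ha0 (hk x hx).2.1
  -- (P2) the enlarged balls have centred average close to `cB`
  have hP2 : ∀ x ∈ Λ', ‖(⨍ w in ball x (4 * sx x), f w) - cB‖ ≤ a := by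
    intro x hx
    obtain ⟨h1, h2, h3⟩ := hk x hx
    by_cases hk2 : 2 ≤ k x
    · -- `4 sx = rad (k - 2)` and the average there is `≤ a` by minimality
      have e1 : 4 * sx x = rad (k x - 2) := by
        show 4 * (ρ / 2 ^ k x) = ρ / 2 ^ (k x - 2)
        obtain ⟨m, hm⟩ := Nat.exists_eq_add_of_le hk2
        rw [hm, Nat.add_sub_cancel_left, pow_add]
        field_simp
        norm_num
      have h4 := h3 (k x - 2) (by omega)
      rw [setAverage_closedBall_eq _ _ (hrad0 _), ← e1] at h4
      calc ‖(⨍ w in ball x (4 * sx x), f w) - cB‖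
          = ‖⨍ w in ball x (4 * sx x), (f w - cB)‖ := by
            rw [setAverage_sub_const (hfB x _) (measure_ball_pos volume x (by positivity)).ne'
              measure_ball_lt_top.ne]
        _ ≤ ⨍ w in ball x (4 * sx x), g w := norm_setAverage_le_setAverage_norm _ _
        _ ≤ a := h4
    · have hk1 : k x = 1 := by omega
      have e1 : 4 * sx x = 2 * ρ := by
        show 4 * (ρ / 2 ^ k x) = 2 * ρ
        rw [hk1, pow_one]; ring
      rw [e1]
      exact (hbig2 x hx.1.1).trans hA2
  -- Vitali
  obtain ⟨u, huΛ, hdisj, hcover⟩ := Vitali.exists_disjoint_subfamily_covering_enlargement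
    (fun x => closedBall x (sx x)) Λ' sx 2 one_lt_two (fun x _ => (hsx0 x).le) ρ
    (fun x hx => (hsxρ x hx).trans (by linarith)) (fun x _ => nonempty_closedBall.mpr (hsx0 x).le)
  have hucount : u.Countable := hdisj.countable_of_nonempty_interior fun x _ =>
    (nonempty_ball.mpr (hsx0 x)).mono ball_subset_interior_closedBall
  -- the points of `Λ'` are covered by the enlarged balls `ball b (4 sx b)`, `b ∈ u`
  have hcov : Λ' ⊆ ⋃ b ∈ u, (Λ' ∩ ball b (4 * sx b)) := by
    intro x hx
    obtain ⟨b, hb, hne, hle⟩ := hcover x hx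
    obtain ⟨y, hy1, hy2⟩ := hne
    refine mem_iUnion₂.mpr ⟨b, hb, hx, ?_⟩
    rw [mem_ball]
    rw [mem_closedBall] at hy1 hy2
    calc dist x b ≤ dist x y + dist y b := dist_triangle _ _ _
      _ = dist y x + dist y b := by rw [dist_comm]
      _ ≤ sx x + sx b := add_le_add hy1 hy2
      _ ≤ 2 * sx b + sx b := by linarith
      _ < 4 * sx b := by linarith [hsx0 b]
  -- each piece is a sublevel set of the enlarged ball
  have hpiece : ∀ b ∈ u, volume (Λ' ∩ ball b (4 * sx b)) ≤ Θ * (ENNReal.ofReal (4 ^ d) * volume (closedBall b (sx b))) := by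
    intro b hb
    have hbΛ : b ∈ Λ' := huΛ hb
    have h1 : Λ' ∩ ball b (4 * sx b) ⊆ {y ∈ ball b (4 * sx b) | lam < ‖f y - ⨍ w in ball b (4 * sx b), f w‖} := by
      rintro y ⟨hyΛ, hyb⟩
      refine ⟨hyb, ?_⟩
      have h2 : lam + a < ‖f y - cB‖ := hyΛ.1.2
      have h3 := hP2 b hbΛ
      have h4 : ‖f y - cB‖ ≤ ‖f y - ⨍ w in ball b (4 * sx b), f w‖ + ‖(⨍ w in ball b (4 * sx b), f w) - cB‖ := by
        calc ‖f y - cB‖ = ‖(f y - ⨍ w in ball b (4 * sx b), f w) + ((⨍ w in ball b (4 * sx b), f w) - cB)‖ := by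
              rw [sub_add_sub_cancel]
          _ ≤ _ := norm_add_le _ _
      linarith
    calc volume (Λ' ∩ ball b (4 * sx b)) ≤ volume {y ∈ ball b (4 * sx b) | lam < ‖f y - ⨍ w in ball b (4 * sx b), f w‖} :=
          measure_mono h1
      _ ≤ Θ * volume (ball b (4 * sx b)) := hΘ b _ (by positivity)
      _ = Θ * (ENNReal.ofReal (4 ^ d) * volume (closedBall b (sx b))) := by
          rw [volume_ball_mul b b (by norm_num) (hsx0 b), volume_closedBall_eq_volume_ball _ (hsx0 b)]
  -- the stopping balls are disjoint, inside `B(z, 2ρ)`, and carry mass `≤ a⁻¹ ∫ g`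
  have hsum : ∑' b : u, volume (closedBall (b : E) (sx b)) ≤
      ENNReal.ofReal a⁻¹ * ∫⁻ y in ball z (2 * ρ), ‖g y‖ₑ := by
    have h1 : ∀ b : u, volume (closedBall (b : E) (sx b)) ≤ ENNReal.ofReal a⁻¹ * ∫⁻ y in closedBall (b : E) (sx b), ‖g y‖ₑ := by
      intro b
      refine (hP1 b (huΛ b.2)).trans (le_of_eq ?_)
      rw [ENNReal.ofReal_mul (by positivity), ofReal_integral_eq_lintegral_ofReal
        ((hgl.integrableOn_isCompact (isCompact_closedBall _ _))) (Eventually.of_forall hg0)]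
      congr 1
      exact lintegral_congr fun y => (Real.enorm_of_nonneg (hg0 y)).symm
    calc ∑' b : u, volume (closedBall (b : E) (sx b))
        ≤ ∑' b : u, ENNReal.ofReal a⁻¹ * ∫⁻ y in closedBall (b : E) (sx b), ‖g y‖ₑ := ENNReal.tsum_le_tsum h1
      _ = ENNReal.ofReal a⁻¹ * ∑' b : u, ∫⁻ y in closedBall (b : E) (sx b), ‖g y‖ₑ := ENNReal.tsum_mul_left
      _ = ENNReal.ofReal a⁻¹ * ∫⁻ y in ⋃ b : u, closedBall (b : E) (sx b), ‖g y‖ₑ := by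
          haveI : Countable u := hucount.to_subtype
          rw [lintegral_iUnion (fun b => measurableSet_closedBall) ?_]
          intro b b' hbb'
          exact hdisj b.2 b'.2 (fun h => hbb' (Subtype.ext h))
      _ ≤ ENNReal.ofReal a⁻¹ * ∫⁻ y in ball z (2 * ρ), ‖g y‖ₑ := by
          gcongr
          refine iUnion_subset fun b => ?_
          intro y hy
          have hb : (b : E) ∈ B := (huΛ b.2).1.1
          rw [mem_closedBall] at hy
          have hb' : dist (b : E) z < ρ := mem_ball.mp hb
          rw [mem_ball]
          have := hsxρ b (huΛ b.2)
          linarith [dist_triangle y (b : E) z]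
  -- the mass of `g` on `B(z, 2ρ)`
  have hmass : ∫⁻ y in ball z (2 * ρ), ‖g y‖ₑ ≤ ENNReal.ofReal ((1 + 2 ^ d) * K * (2 ^ d * volume.real B)) := by
    have h1 : ⨍ y in ball z (2 * ρ), g y ≤ K + 2 ^ d * K := by
      refine (hosc z (2 * ρ) (by positivity)).trans (add_le_add le_rfl ?_)
      have := norm_ballAverage_sub_ballAverage_le hf hK hρ two_pos (ball_subset_ball (by linarith)) le_rfl (x' := z)
      rwa [norm_sub_rev] at this
    have h2 : ∫ y in ball z (2 * ρ), g y ≤ (1 + 2 ^ d) * K * (2 ^ d * volume.real B) := by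
      have hpos : 0 < volume.real (ball z (2 * ρ)) := by
        rw [measureReal_def]; exact ENNReal.toReal_pos (measure_ball_pos volume z (by positivity)).ne' measure_ball_lt_top.ne
      rw [setAverage_eq, smul_eq_mul, inv_mul_le_iff₀ hpos] at h1
      calc ∫ y in ball z (2 * ρ), g y ≤ volume.real (ball z (2 * ρ)) * (K + 2 ^ d * K) := h1
        _ = (1 + 2 ^ d) * K * (2 ^ d * volume.real B) := by rw [hB, volumeReal_ball_mul z z two_pos hρ]; ring
    rw [show (∫⁻ y in ball z (2 * ρ), ‖g y‖ₑ) = ∫⁻ y in ball z (2 * ρ), ENNReal.ofReal (g y) from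
      lintegral_congr fun y => Real.enorm_of_nonneg (hg0 y),
      ← ofReal_integral_eq_lintegral_ofReal (hgB z _) (Eventually.of_forall hg0)]
    exact ENNReal.ofReal_le_ofReal h2
  -- assemble
  have hBreal : ENNReal.ofReal (volume.real B) = volume B := ENNReal.ofReal_toReal measure_ball_lt_top.ne
  calc volume Λ ≤ volume Λ' := hΛΛ'
    _ ≤ volume (⋃ b ∈ u, (Λ' ∩ ball b (4 * sx b))) := measure_mono hcov
    _ ≤ ∑' b : u, volume (Λ' ∩ ball (b : E) (4 * sx b)) := measure_biUnion_le volume hucount _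
    _ ≤ ∑' b : u, Θ * (ENNReal.ofReal (4 ^ d) * volume (closedBall (b : E) (sx b))) :=
        ENNReal.tsum_le_tsum fun b => hpiece b b.2
    _ = Θ * ENNReal.ofReal (4 ^ d) * ∑' b : u, volume (closedBall (b : E) (sx b)) := by
        rw [ENNReal.tsum_mul_left, ENNReal.tsum_mul_left, mul_assoc]
    _ ≤ Θ * ENNReal.ofReal (4 ^ d) * (ENNReal.ofReal a⁻¹ * ENNReal.ofReal ((1 + 2 ^ d) * K * (2 ^ d * volume.real B))) := by
        gcongr
        exact hsum.trans (by gcongr)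
    _ = Θ * (ENNReal.ofReal (4 ^ d) * (ENNReal.ofReal a⁻¹ * ENNReal.ofReal ((1 + 2 ^ d) * K * (2 ^ d * volume.real B)))) := by
        ring
    _ = Θ * (ENNReal.ofReal (4 ^ d * (a⁻¹ * ((1 + 2 ^ d) * K * 2 ^ d))) * ENNReal.ofReal (volume.real B)) := by
        congr 1
        rw [← ENNReal.ofReal_mul (p := a⁻¹) (by positivity), ← ENNReal.ofReal_mul (p := (4 : ℝ) ^ d) (by positivity),
          ← ENNReal.ofReal_mul (p := 4 ^ d * (a⁻¹ * ((1 + 2 ^ d) * K * 2 ^ d))) (by positivity)]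
        congr 1; ring
    _ = 2⁻¹ * Θ * volume B := by
        have e1 : (4 : ℝ) ^ d * (a⁻¹ * ((1 + 2 ^ d) * K * 2 ^ d)) = 2⁻¹ := by
          rw [ha, hA, show (8 : ℝ) ^ d = 4 ^ d * 2 ^ d by rw [← mul_pow]; norm_num]
          have h4 : (4 : ℝ) ^ d ≠ 0 := by positivity
          have h2 : (2 : ℝ) ^ d ≠ 0 := by positivity
          have h2d : (1 + (2 : ℝ) ^ d) ≠ 0 := by positivity
          field_simp
        rw [e1, hBreal, ENNReal.ofReal_inv_of_pos two_pos, ENNReal.ofReal_ofNat, ← mul_assoc, mul_comm Θ]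

end Step

/-! ## Iteration and the John–Nirenberg inequality -/

section Iterate

variable {E : Type*} [NormedAddCommGroup E] [InnerProductSpace ℝ E] [FiniteDimensional ℝ E]
  [MeasureSpaceDummy : MeasurableSpace E] [BorelSpace E]
variable {F : Type*} [NormedAddCommGroup F] [NormedSpace ℝ F] [CompleteSpace F]

/-- **Exponential decay of the level-set ratios** (John–Nirenberg 1961, Lemma 1'): with
`Θ(λ) = sup_B |{y ∈ B : λ < ‖f - f_B‖}|/|B|` and `A = 2·8^d(1+2^d)`, the covering step gives
`Θ(λ + AK) ≤ ½ Θ(λ)`, hence `Θ(nAK) ≤ 2^{-n}`. [cite: JohnNirenberg1961, Lemma 1'] -/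
theorem measure_level_le_pow {f : E → F} (hf : LocallyIntegrable f) {K : ℝ} (hK0 : 0 < K)
    (hK : ∀ (x : E) (r : ℝ), 0 < r → ⨍ z in ball x r, ‖f z - ⨍ w in ball x r, f w‖ ≤ K) (n : ℕ)
    (x : E) {r : ℝ} (hr : 0 < r) :
    volume {y ∈ ball x r | (n : ℝ) * (2 * 8 ^ Module.finrank ℝ E * (1 + 2 ^ Module.finrank ℝ E) * K) <
        ‖f y - ⨍ w in ball x r, f w‖} ≤ (2⁻¹ : ℝ≥0∞) ^ n * volume (ball x r) := by
  set d : ℕ := Module.finrank ℝ E with hd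
  set a : ℝ := 2 * 8 ^ d * (1 + 2 ^ d) * K with ha
  have ha0 : 0 < a := by positivity
  -- the level-set ratio function
  set Θ : ℝ → ℝ≥0∞ := fun lam => ⨆ (x : E) (r : ℝ) (_ : 0 < r),
    volume {y ∈ ball x r | lam < ‖f y - ⨍ w in ball x r, f w‖} / volume (ball x r) with hΘ
  have hvol : ∀ (x : E) {r : ℝ}, 0 < r → volume (ball x r) ≠ 0 ∧ volume (ball x r) ≠ ∞ := fun x r hr =>
    ⟨(measure_ball_pos volume x hr).ne', measure_ball_lt_top.ne⟩
  have hΘ_bound : ∀ (lam : ℝ) (x : E) (r : ℝ), 0 < r →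
      volume {y ∈ ball x r | lam < ‖f y - ⨍ w in ball x r, f w‖} ≤ Θ lam * volume (ball x r) := by
    intro lam x r hr
    have h1 : volume {y ∈ ball x r | lam < ‖f y - ⨍ w in ball x r, f w‖} / volume (ball x r) ≤ Θ lam :=
      le_iSup_of_le x (le_iSup₂_of_le r hr le_rfl)
    rwa [ENNReal.div_le_iff_le_mul (Or.inl (hvol x hr).1) (Or.inl (hvol x hr).2)] at h1
  have hΘ_le_one : ∀ lam, Θ lam ≤ 1 := by
    intro lam
    refine iSup_le fun x => iSup₂_le fun r hr => ?_
    rw [ENNReal.div_le_iff_le_mul (Or.inl (hvol x hr).1) (Or.inl (hvol x hr).2), one_mul]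
    exact measure_mono fun y hy => hy.1
  have hstep : ∀ lam : ℝ, 0 ≤ lam → Θ (lam + a) ≤ 2⁻¹ * Θ lam := by
    intro lam hlam
    refine iSup_le fun x => iSup₂_le fun r hr => ?_
    rw [ENNReal.div_le_iff_le_mul (Or.inl (hvol x hr).1) (Or.inl (hvol x hr).2)]
    exact measure_level_add_le hf hK0 hK hlam (hΘ_bound lam) x hr
  have hiter : ∀ n : ℕ, Θ ((n : ℝ) * a) ≤ (2⁻¹ : ℝ≥0∞) ^ n := by
    intro n
    induction n with
    | zero => simpa using hΘ_le_one 0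
    | succ n ih =>
        have h1 : ((n + 1 : ℕ) : ℝ) * a = (n : ℝ) * a + a := by push_cast; ring
        rw [h1]
        calc Θ ((n : ℝ) * a + a) ≤ 2⁻¹ * Θ ((n : ℝ) * a) := hstep _ (by positivity)
          _ ≤ 2⁻¹ * (2⁻¹ : ℝ≥0∞) ^ n := by gcongr
          _ = (2⁻¹ : ℝ≥0∞) ^ (n + 1) := by rw [pow_succ, mul_comm]
  exact (hΘ_bound _ x r hr).trans (mul_le_mul_left (hiter n) _)

omit [CompleteSpace F] in
/-- The real form of the `BMO` hypothesis: the mean oscillation over every ball is at most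
`K = ‖f‖_*`. [folklore] -/
theorem setAverage_norm_sub_le_toReal {f : E → F} (hf : MemBMO f) (x : E) {r : ℝ} (hr : 0 < r) :
    ⨍ z in ball x r, ‖f z - ⨍ w in ball x r, f w‖ ≤ (eBMOSeminorm f).toReal := by
  have h1 := laverage_oscillation_le_eBMOSeminorm f volume x hr
  have hfi : IntegrableOn f (ball x r) :=
    (hf.locallyIntegrable.integrableOn_isCompact (isCompact_closedBall x r)).mono_set ball_subset_closedBall
  have hint : Integrable (fun z => f z - ⨍ w in ball x r, f w) (volume.restrict (ball x r)) :=
    hfi.sub (integrableOn_const measure_ball_lt_top.ne)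
  have h2 : ⨍ z in ball x r, ‖f z - ⨍ w in ball x r, f w‖ =
      (⨍⁻ z in ball x r, ‖f z - ⨍ w in ball x r, f w‖ₑ ∂volume).toReal := by
    rw [setAverage_eq, setLAverage_eq, ENNReal.toReal_div, integral_norm_eq_lintegral_enorm hint.aestronglyMeasurable,
      smul_eq_mul, measureReal_def, div_eq_inv_mul]
  rw [h2]
  exact ENNReal.toReal_mono hf.eBMOSeminorm_lt_top.ne h1

/-- `(1/2)^⌊t/A⌋ ≤ 2 e^{-(log 2/A) t}`. [folklore] -/
theorem half_pow_floor_le (A t : ℝ) :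
    (1 / 2 : ℝ) ^ ⌊t / A⌋₊ ≤ 2 * Real.exp (-(Real.log 2 / A) * t) := by
  set n : ℕ := ⌊t / A⌋₊ with hn
  have h1 : t / A < n + 1 := Nat.lt_floor_add_one _
  have h2 : -(Real.log 2 / A) * t ≥ -((n + 1) * Real.log 2) := by
    have : Real.log 2 / A * t = (t / A) * Real.log 2 := by ring
    rw [ge_iff_le, neg_mul, neg_le_neg_iff, this]
    exact mul_le_mul_of_nonneg_right h1.le (Real.log_nonneg one_le_two)
  have h3 : Real.exp (-((n + 1) * Real.log 2)) = ((2 : ℝ) ^ (n + 1))⁻¹ := by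
    rw [Real.exp_neg, show ((n : ℝ) + 1) * Real.log 2 = ((n + 1 : ℕ) : ℝ) * Real.log 2 by push_cast; ring,
      Real.exp_nat_mul, Real.exp_log two_pos]
  calc (1 / 2 : ℝ) ^ n = 2 * ((2 : ℝ) ^ (n + 1))⁻¹ := by
        rw [pow_succ, one_div, inv_pow, mul_inv, mul_comm ((2 : ℝ) ^ n)⁻¹, ← mul_assoc,
          mul_inv_cancel₀ (two_ne_zero), one_mul]
    _ = 2 * Real.exp (-((n + 1) * Real.log 2)) := by rw [h3]
    _ ≤ 2 * Real.exp (-(Real.log 2 / A) * t) := by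
        refine mul_le_mul_of_nonneg_left (Real.exp_le_exp.mpr h2) zero_le_two

end Iterate

end JohnNirenberg

open JohnNirenberg in
/-- **The John–Nirenberg inequality** `Literature.Analysis.FunctionSpaces.john_nirenberg` (John–Nirenberg 1961, Lemma 1'; Stein,
*Harmonic Analysis* IV.1.3), discharged: with `A = 2·8^d(1+2^d)`, `d = dim E`, one may take
`c₁ = 2`, `c₂ = log 2 / A`. Proof by the ball-based Calderón–Zygmund iteration of this file
(Vitali covering and Lebesgue differentiation in place of dyadic cubes). [cite: JohnNirenberg1961, Lemma 1'] -/
theorem john_nirenberg_holds : john_nirenberg := by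
  intro E _ _ _ _ _ F _ _ _
  set d : ℕ := Module.finrank ℝ E with hd
  set A : ℝ := 2 * 8 ^ d * (1 + 2 ^ d) with hA
  have hA0 : 0 < A := by positivity
  refine ⟨2, Real.log 2 / A, two_pos, div_pos (Real.log_pos one_lt_two) hA0, ?_⟩
  intro f hf x₀ r hr t ht
  set K : ℝ := (eBMOSeminorm f).toReal with hK
  have hKe : eBMOSeminorm f = ENNReal.ofReal K := (ENNReal.ofReal_toReal hf.eBMOSeminorm_lt_top.ne).symm
  set cB : F := ⨍ w in ball x₀ r, f w with hcB
  -- the level set in real form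
  have hset : {x ∈ ball x₀ r | ENNReal.ofReal t * eBMOSeminorm f < ‖f x - cB‖ₑ} =
      {x ∈ ball x₀ r | t * K < ‖f x - cB‖} := by
    ext x
    simp only [mem_setOf_eq]
    rw [hKe, ← ENNReal.ofReal_mul ht.le, ← ofReal_norm, ENNReal.ofReal_lt_ofReal_iff_of_nonneg (by positivity)]
  rw [hset]
  rcases eq_or_lt_of_le (show (0 : ℝ) ≤ K from ENNReal.toReal_nonneg) with hK0 | hK0
  · -- `‖f‖_* = 0`: `f = f_B` a.e. on `B`
    have hfi : IntegrableOn f (ball x₀ r) :=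
      (hf.locallyIntegrable.integrableOn_isCompact (isCompact_closedBall x₀ r)).mono_set ball_subset_closedBall
    have hint : Integrable (fun z => f z - cB) (volume.restrict (ball x₀ r)) :=
      hfi.sub (integrableOn_const measure_ball_lt_top.ne)
    have h1 : ∫⁻ z in ball x₀ r, ‖f z - cB‖ₑ = 0 := by
      have h2 := laverage_oscillation_le_eBMOSeminorm f volume x₀ hr
      rw [hKe, ← hK0, ENNReal.ofReal_zero, nonpos_iff_eq_zero, setLAverage_eq,
        ENNReal.div_eq_zero_iff] at h2
      rcases h2 with h2 | h2
      · exact h2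
      · exact absurd h2 measure_ball_lt_top.ne
    have h3 : ∀ᵐ z ∂(volume.restrict (ball x₀ r)), ‖f z - cB‖ₑ = 0 :=
      (lintegral_eq_zero_iff' hint.aestronglyMeasurable.enorm).mp h1
    have h4 : volume ({z | ¬ (‖f z - cB‖ₑ = 0)} ∩ ball x₀ r) = 0 := by
      rw [← Measure.restrict_apply' measurableSet_ball]
      exact ae_iff.mp h3
    have h0 : t * K = 0 := by rw [← hK0, mul_zero]
    have h5 : {x ∈ ball x₀ r | t * K < ‖f x - cB‖} ⊆ {z | ¬ (‖f z - cB‖ₑ = 0)} ∩ ball x₀ r := by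
      intro x hx
      refine ⟨?_, hx.1⟩
      have hpos : 0 < ‖f x - cB‖ := by have := hx.2; rwa [h0] at this
      rw [mem_setOf_eq, ← ofReal_norm, ENNReal.ofReal_eq_zero, not_le]
      exact hpos
    calc volume {x ∈ ball x₀ r | t * K < ‖f x - cB‖} ≤ volume ({z | ¬ (‖f z - cB‖ₑ = 0)} ∩ ball x₀ r) :=
          measure_mono h5
      _ = 0 := h4
      _ ≤ _ := zero_le
  · have hKball := fun x ρ (hρ : 0 < ρ) => setAverage_norm_sub_le_toReal hf x hρ
    set n : ℕ := ⌊t / A⌋₊ with hn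
    have hnle : (n : ℝ) * (2 * 8 ^ d * (1 + 2 ^ d) * K) ≤ t * K := by
      have h1 : (n : ℝ) ≤ t / A := Nat.floor_le (by positivity)
      have h2 : (n : ℝ) * A ≤ t := by rwa [le_div_iff₀ hA0] at h1
      calc (n : ℝ) * (2 * 8 ^ d * (1 + 2 ^ d) * K) = ((n : ℝ) * A) * K := by rw [hA]; ring
        _ ≤ t * K := mul_le_mul_of_nonneg_right h2 hK0.le
    calc volume {x ∈ ball x₀ r | t * K < ‖f x - cB‖}
        ≤ volume {x ∈ ball x₀ r | (n : ℝ) * (2 * 8 ^ d * (1 + 2 ^ d) * K) < ‖f x - cB‖} :=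
          measure_mono fun x hx => ⟨hx.1, lt_of_le_of_lt hnle hx.2⟩
      _ ≤ (2⁻¹ : ℝ≥0∞) ^ n * volume (ball x₀ r) := measure_level_le_pow hf.locallyIntegrable hK0 hKball n x₀ hr
      _ ≤ ENNReal.ofReal (2 * Real.exp (-(Real.log 2 / A) * t)) * volume (ball x₀ r) := by
          gcongr
          rw [← ENNReal.ofReal_ofNat 2, ← ENNReal.ofReal_inv_of_pos two_pos, ← ENNReal.ofReal_pow (by norm_num),
            ← one_div]
          exact ENNReal.ofReal_le_ofReal (half_pow_floor_le A t)


end Literature.Analysis.FunctionSpaces
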